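import Summits.QuantumFields.YangMills.Theorems.BalabanUVNodesN18TwoRunLettersCalculusResolvent

/-!
# BalabanUVNodes ∕ N18 — THE TWO-RUN CLOSENESS-LETTER CALCULUS, PART 3 (INVERSES, SECOND ORDER): the σ-LOCALISED two-run
# closeness letter (C2) of `N18TwoRunLetters.termWalkData_of_staticLetters_at_window` for the INVERSE `σ ↦ (A(σ))⁻¹` of a static
# precision family — the second-order resolvent expansion (three triple products, one differenced line each); companion of part 1
# `…N18TwoRunLettersCalculus` (products) and part 2 `…N18TwoRunLettersCalculusResolvent` (§4 `close_inv` = (C1) of the inverse)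
# (Track A, DAG node N18 = NE5 `T4OutputRate.NE5 EA EB W κ θ C₅`; cluster K4 «SpineRates»)

Cell `pub-ymgap`, HUMAN RULING D-0149 (T⁴ apex work-bound push), width seat `pub-ymgap-dag-n18-w1` (g0); W-SEAT-START-LIST v3 §2 n18 item 1
(«`N18At` at the record … start from `…N18EndLetters` ∕ `…N18TwoRunLetters` currency»), SUB-LEMMA «two-run closeness-letter calculus», part 3.
`--kind proof --supports stmt-QuantumFields-20544` (K3⁷ `SpineGivenEndpointR13SepCoPH`) as a HELPER — COUNT-NEUTRAL.

HONEST FRAMING.  Finite-matrix bookkeeping; THEOREMS ONLY, 0 `def`, 0 `sorry`, standard axioms.  Every letter is a HYPOTHESIS about abstract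
static precision families `σ ↦ A(σ)` ∕ `σ ↦ P(σ)`; nothing of Bałaban's `Γ_k`, `Δ^{(k)}(Z₀,σ,𝐔,𝐉)`, `C^{(k)}`, `(C^{(k)})^{1/2}` is constructed or asserted;
the PRIMITIVE two-run closeness letters (rows NE2∕NE3's η-rate for Bałaban's propagators at two lattice spacings; NODE O 0∕1) are NOT supplied; NE5
NOT IN PRINT ([Balaban1987RG1] Thm 1 p. 259) and NOT PROVED; N18 NOT discharged; counts UNMOVED (typed 28∕28 · discharged 5∕27); one finite
four-torus programme at fixed ε — NOT continuum, NOT ℝ⁴, NOT OS, NOT a mass gap, NOT Clay.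
A6 ∕ SATISFIABILITY (№189).  The displayed hypotheses of every theorem below are JOINTLY SATISFIABLE — e.g. identical runs (`K_A = K_B`, `A_A = A_B`,
`P_A = P_B`, rate `ϱ = 0`) with constant-in-σ families, the precision `P(σ) := m·1` (range one, `m`-accretive, off-diagonal sums `0`), any `X ≠ ∅` — so no
statement is vacuous; they carry CONTENT only when instantiated at Bałaban's primitives with rows NE2∕NE3's rate, which this file does not do.

WHAT (binder shapes = `N18TwoRunLetters` §3∕§4; (C2) = the two-run difference of the σ-localised pieces `K(σ) − K(0)` through `X`):
* §7 ★ `locClose_inv` — with `R^X(σ) := (A_X(σ))⁻¹` and `E^X := A_X(0) − A_X(σ)`: `R^X(σ) − R^X(0) = R^X(σ)E^XR^X(0)` (`Matrix.inv_sub_inv`), and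
  `[R^B(σ) − R^B(0)] − [R^A(σ) − R^A(0)] = (R^B(σ) − R^A(σ))E^BR^B(0) + R^A(σ)(E^B − E^A)R^B(0) + R^A(σ)E^A(R^B(0) − R^A(0))` — the outer differenced
  lines are part 2's `close_inv` ((C1) of the inverse, at `σ` and at `0`), the middle one is the precision's own (C2); every middle factor is localised
  THROUGH `X` (part 1 `norm_mul_apply_le_of_decayX_right ∕ _left`).  From (C3) invertibility + NODE O's (L4) for BOTH runs (amplitude `B_C`), (L2) of BOTH
  precisions (`B_E′`), the two-run (C1) (`D_E`) and (C2) (`D_E′`) of the precision, all at decay `ρ`, volume sums `c_V` at margin `η`, `X ≠ ∅`: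
  (C2) for the inverses at rate `ϱ`, amplitude `2B_C³B_E′D_Ec_V⁴ + B_C²D_E′c_V²`, decay `ρ′` with `ρ′ + 4η ≤ ρ`.
* §7b `inv_letters_of_accretive` — the precision slot's OWN inputs (C3) `A(σ)·(A(σ))⁻¹ = 1` and NODE O's (L4) `‖(A(σ))⁻¹_{ik}‖ ≤ (2∕m)·e^{−ρd₁}` from
  ACCRETIVITY alone (`B13Sqrt27Accretive.resolvent_decay` at `x = 0`): the hypotheses `hinv· ∕ hC4·` of `close_inv` ∕ `locClose_inv` and the END's `hAC ∕ hC4`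
  run on the same accretive range-one data as the square root's letters.
NOT COVERED (honest): letters for Bałaban's actual primitives; the END's other binders.  The square root's (C2) is part 4 (`…CalculusSqrtLoc`).

Sources (mechanism and shapes only; nothing printed is asserted): T. Bałaban, CMP **116** (1988) [Balaban1988RG2Cluster] (1.11) p. 5, p. 13, (2.16)
p. 16; CMP **99** (1985) [Balaban1985BackgroundPropagators] (3.93) p. 410, Thm 3.10 p. 416; C. King, CMP **102** (1986) [King1986] p. 665 («difference
of propagators on one line»).  Nothing here is a claim about the Yang–Mills mass gap.
-/

noncomputable section

namespace Summit.QuantumFields.YangMills.BalabanUVNodes.N18TwoRunLettersCalculusInvLoc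

open Metric Set Finset
open scoped Matrix
open Literature.MathematicalPhysics.QuantumFieldTheory.Balaban1983to89
open Literature.MathematicalPhysics.QuantumFieldTheory.Balaban1983to89.B9Thm37GlueTorus (tdist1 tdist1_nonneg)
open Literature.MathematicalPhysics.QuantumFieldTheory.Balaban1983to89.TreeLengthTorus (TPt)
open Literature.MathematicalPhysics.QuantumFieldTheory.Balaban1983to89.B5TorusCover (UT)
open Literature.MathematicalPhysics.QuantumFieldTheory.Balaban1983to89.NodeOLetters (distX distX_nonneg)
open Literature.MathematicalPhysics.QuantumFieldTheory.Balaban1983to89.B13Sqrt27Accretive (resolvent_decay)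
open Summit.QuantumFields.YangMills.BalabanUVNodes.N18TwoRunLettersCalculus (norm_mul_apply_le_of_decayX_left norm_mul_apply_le_of_decayX_right)
open Summit.QuantumFields.YangMills.BalabanUVNodes.N18TwoRunLettersCalculusResolvent (close_inv)

variable {d N' : ℕ} {ν : ℕ} {Nf : Fin ν → ℕ} [∀ i, NeZero (Nf i)]

omit [∀ i, NeZero (Nf i)] in
/-- `σ = 0` lies in the polydisc `‖σ_j‖ ≤ e^{κ₁}` (plumbing). [folklore] -/
private theorem zero_mem_polydisc' (c : B13.Consts) : ∀ j, ‖(0 : TPt d N' → ℂ) j‖ ≤ Real.exp c.κ₁ :=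
  fun _ => by simpa using (Real.exp_pos c.κ₁).le

/-! ## §7 INVERSES, SECOND ORDER: (C2) of `σ ↦ (A(σ))⁻¹` — the σ-localised two-run difference of the inverse precision -/

section InverseLoc

variable {Λ : Type} [Fintype Λ] [DecidableEq Λ] {c : B13.Consts} {locΛ : Λ → UT Nf}
  {AA AB : (TPt d N' → ℂ) → Matrix Λ Λ ℂ} {X : Finset (UT Nf)} {ρ ρ' η cV ϱ BC BE' DE DE' : ℝ}

/-- **(C2) OF THE INVERSE PRECISION** (second-order resolvent expansion).  With `R^X(σ) := (A_X(σ))⁻¹` and `E^X := A_X(0) − A_X(σ)`,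
`R^X(σ) − R^X(0) = R^X(σ)E^XR^X(0)` (`Matrix.inv_sub_inv`), and the two-run difference of these σ-localised pieces splits as
`(R^B(σ) − R^A(σ))E^BR^B(0) + R^A(σ)(E^B − E^A)R^B(0) + R^A(σ)E^A(R^B(0) − R^A(0))` — three triple products, ONE differenced line each (the outer
ones differenced by §4 `close_inv`, the middle one by the precision's own (C2)), the middle factor always localised THROUGH `X`.  Hypotheses on
the polydisc (which contains `σ = 0`): (C3) invertibility and NODE O's (L4) (amplitude `B_C`) for BOTH runs, (L2) of BOTH precisions (amplitude
`B_E′`), the two-run letters (C1) (amplitude `D_E`) and (C2) (amplitude `D_E′`) of the precision, all at decay `ρ`; volume sums `c_V` at margin `η`;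
`X ≠ ∅` ⟹ (C2) for the inverses at rate `ϱ`, amplitude `2B_C³B_E′D_Ec_V⁴ + B_C²D_E′c_V²`, decay `ρ′` with `ρ′ + 4η ≤ ρ` (part 1 §1 four times).
[cite: King1986, p.665; Balaban1988RG2Cluster, (1.11) p.5, p.13, (2.16) p.16; Balaban1985BackgroundPropagators, (3.93) p.410, Thm 3.10 p.416] -/
theorem locClose_inv (hX : X.Nonempty) (hϱ : 0 ≤ ϱ) (hBC : 0 ≤ BC) (hBE' : 0 ≤ BE') (hDE : 0 ≤ DE) (hDE' : 0 ≤ DE')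
    (hρ' : 0 ≤ ρ') (hη : 0 ≤ η) (hsplit : ρ' + 4 * η ≤ ρ)
    (hinvA : ∀ σ : TPt d N' → ℂ, (∀ j, ‖σ j‖ ≤ Real.exp c.κ₁) → AA σ * (AA σ)⁻¹ = 1)
    (hinvB : ∀ σ : TPt d N' → ℂ, (∀ j, ‖σ j‖ ≤ Real.exp c.κ₁) → AB σ * (AB σ)⁻¹ = 1)
    (hC4A : ∀ σ : TPt d N' → ℂ, (∀ j, ‖σ j‖ ≤ Real.exp c.κ₁) →
      ∀ i k, ‖(AA σ)⁻¹ i k‖ ≤ BC * Real.exp (-(ρ * tdist1 Nf (locΛ i) (locΛ k))))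
    (hC4B : ∀ σ : TPt d N' → ℂ, (∀ j, ‖σ j‖ ≤ Real.exp c.κ₁) →
      ∀ i k, ‖(AB σ)⁻¹ i k‖ ≤ BC * Real.exp (-(ρ * tdist1 Nf (locΛ i) (locΛ k))))
    (hA' : ∀ σ : TPt d N' → ℂ, (∀ j, ‖σ j‖ ≤ Real.exp c.κ₁) →
      ∀ i k, ‖AA σ i k - AA 0 i k‖ ≤ BE' * Real.exp (-(ρ * distX X (locΛ i) (locΛ k))))
    (hB' : ∀ σ : TPt d N' → ℂ, (∀ j, ‖σ j‖ ≤ Real.exp c.κ₁) →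
      ∀ i k, ‖AB σ i k - AB 0 i k‖ ≤ BE' * Real.exp (-(ρ * distX X (locΛ i) (locΛ k))))
    (hclose : ∀ σ : TPt d N' → ℂ, (∀ j, ‖σ j‖ ≤ Real.exp c.κ₁) →
      ∀ i k, ‖AB σ i k - AA σ i k‖ ≤ ϱ * (DE * Real.exp (-(ρ * tdist1 Nf (locΛ i) (locΛ k)))))
    (hloc : ∀ σ : TPt d N' → ℂ, (∀ j, ‖σ j‖ ≤ Real.exp c.κ₁) →
      ∀ i k, ‖(AB σ i k - AB 0 i k) - (AA σ i k - AA 0 i k)‖ ≤ ϱ * (DE' * Real.exp (-(ρ * distX X (locΛ i) (locΛ k)))))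
    (hvol : ∀ i, ∑ k, Real.exp (-(η * tdist1 Nf (locΛ i) (locΛ k))) ≤ cV)
    (hvol' : ∀ j, ∑ k, Real.exp (-(η * tdist1 Nf (locΛ k) (locΛ j))) ≤ cV) :
    ∀ σ : TPt d N' → ℂ, (∀ j, ‖σ j‖ ≤ Real.exp c.κ₁) →
      ∀ i j, ‖((AB σ)⁻¹ i j - (AB 0)⁻¹ i j) - ((AA σ)⁻¹ i j - (AA 0)⁻¹ i j)‖
        ≤ ϱ * ((2 * BC ^ 3 * BE' * DE * cV ^ 4 + BC ^ 2 * DE' * cV ^ 2) * Real.exp (-(ρ' * distX X (locΛ i) (locΛ j)))) := by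
  intro σ hσ i j
  have h0 := zero_mem_polydisc' (d := d) (N' := N') c
  have hcV : 0 ≤ cV := (Finset.sum_nonneg fun k _ => (Real.exp_pos _).le).trans (hvol i)
  -- units
  have hU : ∀ τ : TPt d N' → ℂ, (∀ j, ‖τ j‖ ≤ Real.exp c.κ₁) → IsUnit (AA τ) ∧ IsUnit (AB τ) := fun τ hτ =>
    ⟨(Matrix.isUnit_iff_isUnit_det _).2 (Matrix.isUnit_det_of_right_inverse (hinvA τ hτ)),
     (Matrix.isUnit_iff_isUnit_det _).2 (Matrix.isUnit_det_of_right_inverse (hinvB τ hτ))⟩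
  -- the σ-localised pieces of the inverses as triple products
  have hRA : (AA σ)⁻¹ - (AA 0)⁻¹ = (AA σ)⁻¹ * (AA 0 - AA σ) * (AA 0)⁻¹ := Matrix.inv_sub_inv (iff_of_true (hU σ hσ).1 (hU 0 h0).1)
  have hRB : (AB σ)⁻¹ - (AB 0)⁻¹ = (AB σ)⁻¹ * (AB 0 - AB σ) * (AB 0)⁻¹ := Matrix.inv_sub_inv (iff_of_true (hU σ hσ).2 (hU 0 h0).2)
  have hsplitM : ((AB σ)⁻¹ - (AB 0)⁻¹) - ((AA σ)⁻¹ - (AA 0)⁻¹) =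
      ((AB σ)⁻¹ - (AA σ)⁻¹) * (AB 0 - AB σ) * (AB 0)⁻¹ + (AA σ)⁻¹ * ((AB 0 - AB σ) - (AA 0 - AA σ)) * (AB 0)⁻¹
        + (AA σ)⁻¹ * (AA 0 - AA σ) * ((AB 0)⁻¹ - (AA 0)⁻¹) := by
    rw [hRA, hRB]; simp only [Matrix.sub_mul, Matrix.mul_sub]; abel
  -- rates
  set ρ₁ := ρ' + 2 * η with hρ₁def
  set ρ₂ := ρ' + η with hρ₂def
  have hρ₁0 : 0 ≤ ρ₁ := by positivity
  have hρ₂0 : 0 ≤ ρ₂ := by positivity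
  have hρ₁ρ : ρ₁ ≤ ρ := by linarith
  have hρ₁split : ρ₁ + 2 * η ≤ ρ := by linarith
  have hρ₂split : ρ₂ + η ≤ ρ₁ := by simp only [hρ₁def, hρ₂def]; linarith
  have hρ'split : ρ' + η ≤ ρ₂ := by simp only [hρ₂def]; linarith
  have wkX : ∀ {w : ℝ}, 0 ≤ w → Real.exp (-(ρ * w)) ≤ Real.exp (-(ρ₁ * w)) := fun hw =>
    Real.exp_le_exp.2 (neg_le_neg (mul_le_mul_of_nonneg_right hρ₁ρ hw))
  -- (C1) of the inverses at decay ρ₁ (§4), at σ and at 0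
  have hCinv := close_inv (c := c) (locΛ := locΛ) (AA := AA) (AB := AB) hϱ hDE hBC hρ₁0 hη hρ₁split hinvA hinvB hC4A hC4B hclose hvol
  -- letters at decay ρ₁ (weakened)
  have hC4A₁ : ∀ τ : TPt d N' → ℂ, (∀ j, ‖τ j‖ ≤ Real.exp c.κ₁) → ∀ i k, ‖(AA τ)⁻¹ i k‖ ≤ BC * Real.exp (-(ρ₁ * tdist1 Nf (locΛ i) (locΛ k))) :=
    fun τ hτ i k => (hC4A τ hτ i k).trans (mul_le_mul_of_nonneg_left (wkX (tdist1_nonneg _ _)) hBC)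
  have hC4B₁ : ∀ τ : TPt d N' → ℂ, (∀ j, ‖τ j‖ ≤ Real.exp c.κ₁) → ∀ i k, ‖(AB τ)⁻¹ i k‖ ≤ BC * Real.exp (-(ρ₁ * tdist1 Nf (locΛ i) (locΛ k))) :=
    fun τ hτ i k => (hC4B τ hτ i k).trans (mul_le_mul_of_nonneg_left (wkX (tdist1_nonneg _ _)) hBC)
  have hEB₁ : ∀ i k, ‖(AB 0 - AB σ) i k‖ ≤ BE' * Real.exp (-(ρ₁ * distX X (locΛ i) (locΛ k))) := fun i k => by
    rw [Matrix.sub_apply, norm_sub_rev]; exact (hB' σ hσ i k).trans (mul_le_mul_of_nonneg_left (wkX (distX_nonneg X _ _)) hBE')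
  have hEA₁ : ∀ i k, ‖(AA 0 - AA σ) i k‖ ≤ BE' * Real.exp (-(ρ₁ * distX X (locΛ i) (locΛ k))) := fun i k => by
    rw [Matrix.sub_apply, norm_sub_rev]; exact (hA' σ hσ i k).trans (mul_le_mul_of_nonneg_left (wkX (distX_nonneg X _ _)) hBE')
  have hEd₁ : ∀ i k, ‖((AB 0 - AB σ) - (AA 0 - AA σ)) i k‖ ≤ ϱ * DE' * Real.exp (-(ρ₁ * distX X (locΛ i) (locΛ k))) := fun i k => by
    have e : ((AB 0 - AB σ) - (AA 0 - AA σ)) i k = -((AB σ i k - AB 0 i k) - (AA σ i k - AA 0 i k)) := by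
      simp only [Matrix.sub_apply]; ring
    rw [e, norm_neg, mul_assoc]
    exact (hloc σ hσ i k).trans (mul_le_mul_of_nonneg_left (mul_le_mul_of_nonneg_left (wkX (distX_nonneg X _ _)) hDE') hϱ)
  -- term 1: (R^B(σ) − R^A(σ)) · E^B · R^B(0)
  have t1a := norm_mul_apply_le_of_decayX_right locΛ locΛ locΛ hX (M₁ := (AB σ)⁻¹ - (AA σ)⁻¹) (M₂ := AB 0 - AB σ)
    (a := ϱ * (BC ^ 2 * DE * cV ^ 2)) (b := BE') (by positivity) hBE' hρ₂0 hη hρ₂split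
    (fun i k => by rw [Matrix.sub_apply, mul_assoc]; exact hCinv σ hσ i k) hEB₁ hvol
  have t1 := norm_mul_apply_le_of_decayX_left locΛ locΛ locΛ hX (M₁ := ((AB σ)⁻¹ - (AA σ)⁻¹) * (AB 0 - AB σ)) (M₂ := (AB 0)⁻¹)
    (a := ϱ * (BC ^ 2 * DE * cV ^ 2) * BE' * cV) (b := BC) (by positivity) hBC hρ' hη hρ'split t1a
    (fun k j => (hC4B₁ 0 h0 k j).trans (mul_le_mul_of_nonneg_left
      (Real.exp_le_exp.2 (neg_le_neg (mul_le_mul_of_nonneg_right (by linarith) (tdist1_nonneg _ _)))) hBC)) hvol' i j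
  -- term 2: R^A(σ) · (E^B − E^A) · R^B(0)
  have t2a := norm_mul_apply_le_of_decayX_right locΛ locΛ locΛ hX (M₁ := (AA σ)⁻¹) (M₂ := (AB 0 - AB σ) - (AA 0 - AA σ))
    (a := BC) (b := ϱ * DE') hBC (by positivity) hρ₂0 hη hρ₂split (hC4A₁ σ hσ) hEd₁ hvol
  have t2 := norm_mul_apply_le_of_decayX_left locΛ locΛ locΛ hX (M₁ := (AA σ)⁻¹ * ((AB 0 - AB σ) - (AA 0 - AA σ))) (M₂ := (AB 0)⁻¹)
    (a := BC * (ϱ * DE') * cV) (b := BC) (by positivity) hBC hρ' hη hρ'split t2a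
    (fun k j => (hC4B₁ 0 h0 k j).trans (mul_le_mul_of_nonneg_left
      (Real.exp_le_exp.2 (neg_le_neg (mul_le_mul_of_nonneg_right (by linarith) (tdist1_nonneg _ _)))) hBC)) hvol' i j
  -- term 3: R^A(σ) · E^A · (R^B(0) − R^A(0))
  have t3a := norm_mul_apply_le_of_decayX_right locΛ locΛ locΛ hX (M₁ := (AA σ)⁻¹) (M₂ := AA 0 - AA σ)
    (a := BC) (b := BE') hBC hBE' hρ₂0 hη hρ₂split (hC4A₁ σ hσ) hEA₁ hvol
  have t3 := norm_mul_apply_le_of_decayX_left locΛ locΛ locΛ hX (M₁ := (AA σ)⁻¹ * (AA 0 - AA σ)) (M₂ := (AB 0)⁻¹ - (AA 0)⁻¹)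
    (a := BC * BE' * cV) (b := ϱ * (BC ^ 2 * DE * cV ^ 2)) (by positivity) (by positivity) hρ' hη hρ'split t3a
    (fun k j => by
      rw [Matrix.sub_apply, mul_assoc]
      exact (hCinv 0 h0 k j).trans (mul_le_mul_of_nonneg_left (mul_le_mul_of_nonneg_left
        (Real.exp_le_exp.2 (neg_le_neg (mul_le_mul_of_nonneg_right (by linarith) (tdist1_nonneg _ _)))) (by positivity)) hϱ)) hvol' i j
  rw [← Matrix.sub_apply, ← Matrix.sub_apply, ← Matrix.sub_apply, hsplitM, Matrix.add_apply, Matrix.add_apply]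
  set e := Real.exp (-(ρ' * distX X (locΛ i) (locΛ j)))
  calc ‖(((AB σ)⁻¹ - (AA σ)⁻¹) * (AB 0 - AB σ) * (AB 0)⁻¹) i j + ((AA σ)⁻¹ * ((AB 0 - AB σ) - (AA 0 - AA σ)) * (AB 0)⁻¹) i j
        + ((AA σ)⁻¹ * (AA 0 - AA σ) * ((AB 0)⁻¹ - (AA 0)⁻¹)) i j‖
      ≤ ‖(((AB σ)⁻¹ - (AA σ)⁻¹) * (AB 0 - AB σ) * (AB 0)⁻¹) i j‖ + ‖((AA σ)⁻¹ * ((AB 0 - AB σ) - (AA 0 - AA σ)) * (AB 0)⁻¹) i j‖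
        + ‖((AA σ)⁻¹ * (AA 0 - AA σ) * ((AB 0)⁻¹ - (AA 0)⁻¹)) i j‖ := (norm_add_le _ _).trans (add_le_add (norm_add_le _ _) le_rfl)
    _ ≤ ϱ * (BC ^ 2 * DE * cV ^ 2) * BE' * cV * BC * cV * e + BC * (ϱ * DE') * cV * BC * cV * e
        + BC * BE' * cV * (ϱ * (BC ^ 2 * DE * cV ^ 2)) * cV * e := add_le_add (add_le_add t1 t2) t3
    _ = ϱ * ((2 * BC ^ 3 * BE' * DE * cV ^ 4 + BC ^ 2 * DE' * cV ^ 2) * e) := by ring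

end InverseLoc

/-! ## §7b The precision slot's own letters from ACCRETIVITY: (C3) invertibility and NODE O's (L4) — `resolvent_decay` at `x = 0` -/

section InvLetters

variable {Λ : Type} [Fintype Λ] [DecidableEq Λ] {c : B13.Consts}

/-- **(C3) AND (L4) OF A STATIC PRECISION FAMILY FROM ACCRETIVITY ALONE** — the inputs `hinvA ∕ hinvB ∕ hC4A ∕ hC4B` of part 2's `close_inv` and of §7
`locClose_inv` (and the END's `hAC ∕ hC4` for run A) for an `m`-accretive range-one family with off-diagonal sums `≤ h`, `h(e^θ − 1) ≤ m∕2`, located bonds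
`d₁(loc i, loc j) ≤ s·dist i j` and `ρ·s ≤ θ`: on the polydisc, `A(σ)·(A(σ))⁻¹ = 1` and `‖(A(σ))⁻¹_{ik}‖ ≤ (2∕m)·e^{−ρd₁(loc i, loc k)}` — dag-n10-b's
`B13Sqrt27Accretive.resolvent_decay` (accretive Combes–Thomas) at the spectral parameter `x = 0`.  So the precision slot's two-run calculus runs on the SAME
accretivity data as the square root's. [cite: Balaban1988RG2Cluster, (2.7) p.13, p.15; Balaban1985BackgroundPropagators, Thm 3.10 p.416] -/
theorem inv_letters_of_accretive (locΛ : Λ → UT Nf) (A : (TPt d N' → ℂ) → Matrix Λ Λ ℂ)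
    (dist : Λ → Λ → ℕ) (hd0 : ∀ i, dist i i = 0) (hds : ∀ i j, dist i j = dist j i)
    (hdt : ∀ i j k, dist i k ≤ dist i j + dist j k)
    {s : ℝ} (hloc : ∀ i j, tdist1 Nf (locΛ i) (locΛ j) ≤ s * dist i j)
    {h m θ ρ : ℝ} (hm : 0 < m) (hθ : 0 ≤ θ) (hhθ : h * (Real.exp θ - 1) ≤ m / 2) (hρ0 : 0 ≤ ρ) (hρθ : ρ * s ≤ θ)
    (hrange : ∀ σ : TPt d N' → ℂ, (∀ j, ‖σ j‖ ≤ Real.exp c.κ₁) → ∀ i j, A σ i j ≠ 0 → dist i j ≤ 1)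
    (hrow : ∀ σ : TPt d N' → ℂ, (∀ j, ‖σ j‖ ≤ Real.exp c.κ₁) → ∀ i, ∑ j ∈ univ.filter (fun j => dist i j ≠ 0), ‖A σ i j‖ ≤ h)
    (hcol : ∀ σ : TPt d N' → ℂ, (∀ j, ‖σ j‖ ≤ Real.exp c.κ₁) → ∀ j, ∑ i ∈ univ.filter (fun i => dist i j ≠ 0), ‖A σ i j‖ ≤ h)
    (hacc : ∀ σ : TPt d N' → ℂ, (∀ j, ‖σ j‖ ≤ Real.exp c.κ₁) →
      ∀ v : Λ → ℂ, m * ∑ i, ‖v i‖ ^ 2 ≤ (∑ i, star (v i) * (A σ *ᵥ v) i).re) :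
    (∀ σ : TPt d N' → ℂ, (∀ j, ‖σ j‖ ≤ Real.exp c.κ₁) → A σ * (A σ)⁻¹ = 1) ∧
      (∀ σ : TPt d N' → ℂ, (∀ j, ‖σ j‖ ≤ Real.exp c.κ₁) →
        ∀ i k, ‖(A σ)⁻¹ i k‖ ≤ 2 / m * Real.exp (-(ρ * tdist1 Nf (locΛ i) (locΛ k)))) := by
  have key : ∀ σ : TPt d N' → ℂ, (∀ j, ‖σ j‖ ≤ Real.exp c.κ₁) →
      IsUnit (A σ).det ∧ ∀ i k, ‖(A σ)⁻¹ i k‖ ≤ 2 / m * Real.exp (-(θ * dist i k)) := by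
    intro σ hσ
    have h0 := resolvent_decay dist hd0 hds hdt (A σ) (hrange σ hσ) h (hrow σ hσ) (hcol σ hσ) m θ hm hθ (hacc σ hσ) hhθ (x := 0) le_rfl
    simp only [Complex.ofReal_zero, zero_smul, zero_add, add_zero] at h0
    exact h0
  have hrate : ∀ i k, ρ * tdist1 Nf (locΛ i) (locΛ k) ≤ θ * (dist i k : ℝ) := by
    intro i k
    have hdik : (0 : ℝ) ≤ dist i k := Nat.cast_nonneg _
    calc ρ * tdist1 Nf (locΛ i) (locΛ k) ≤ ρ * (s * dist i k) := mul_le_mul_of_nonneg_left (hloc i k) hρ0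
      _ = (ρ * s) * dist i k := by ring
      _ ≤ θ * dist i k := mul_le_mul_of_nonneg_right hρθ hdik
  refine ⟨fun σ hσ => Matrix.mul_nonsing_inv _ (key σ hσ).1, fun σ hσ i k => ?_⟩
  exact ((key σ hσ).2 i k).trans (mul_le_mul_of_nonneg_left (Real.exp_le_exp.2 (neg_le_neg (hrate i k))) (by positivity))

end InvLetters

end Summit.QuantumFields.YangMills.BalabanUVNodes.N18TwoRunLettersCalculusInvLoc

end
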